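import Literature.NumberTheory.EllipticCurves.BinaryQuarticPadicMinimisationProofs
import HarnessLib

/-!
# Every `ℚ_p`-soluble class with invariants `(2⁴I, 2⁶J)`, `(I, J) ∈ F_p^{inv}`, has an integral
# representative (Bhargava–Shankar, proof of Prop. 5.12: `B_p^{I,J} ⊂ V_{ℤ_p}`)

`Proofs` companion (theorems only: no definitions, no named facts) of
`BinaryQuarticPadicMinimisationProofs.lean` (the minimisation lemmas 5.3–5.5 over `ℤ_p`).

Source. M. Bhargava, A. Shankar, *Binary quartic forms having bounded invariants, and the
boundedness of the average rank of elliptic curves*, Ann. of Math. (2) 181 (2015) 191–242, proof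
of Prop. 5.12 of the held arXiv text `arXiv:1006.1002v2` (= Prop. 3.9 / Cor. 3.8 of the published
version): "For `(I,J) ∈ F_p^{inv}`, let `B_p^{I,J}` consist of a set of representatives
`f₁, …, f_k ∈ V_{ℤ_p}` for the action of `PGL₂(ℚ_p)` on the set of soluble binary quartic forms in
`V_{ℤ_p}` having invariants equal to `2⁴I` and `2⁶J` … By Lemmas 5.10 and 5.11, elements
`f ∈ B_p^{I,J}` correspond bijectively with elements `σ ∈ E_{I,J}/2E_{I,J}`". Lemma 5.10
parametrizes the soluble classes of forms over the *field* `ℚ_p`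
(`BhargavaShankarFieldParametrization.lean`); the printed bijection for *integral* representatives
thus contains the assertion proved here — the local counterpart of the proof of Thm 5.6 (p. 32:
"use Lemma 5.3 to remove powers of `p ≥ 5` … Lemma 5.4 … Lemma 5.5, multiple times if
necessary"):

* `BinaryQuartic.exists_integral_kEquiv_of_level` — for `(A, B) ∈ ℤ_p²` with `4A³ + 27B² ≠ 0`,
  an integral `ℚ_p`-soluble `g` with invariants `(p^{4k}·2⁴·(−3A), p^{6k}·2⁶·(−27B))` is
  `ℚ_p`-equivalent to an integral form with invariants exactly `(2⁴·(−3A), 2⁶·(−27B))`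
  (`k` applications of the `p`-adic minimisation lemma for the residue characteristic at hand);
* `BinaryQuartic.exists_integral_pgl2Equiv_of_isSoluble` — **for `(I, J) = (−3A, −27B)` with
  `A, B ∈ ℤ_p`, `AB ≠ 0`, `4A³ + 27B² ≠ 0`, every `ℚ_p`-soluble `f ∈ V_{ℚ_p}` with invariants
  `(2⁴I, 2⁶J)` is `PGL₂(ℚ_p)`-equivalent to a form in `V_{ℤ_p}`** (scale `f` to `p^{2k} f ∈ V_{ℤ_p}`,
  minimise `k` times, and use that `ℚ_p`-equivalent forms with the same invariants `I, J ≠ 0` are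
  `PGL₂(ℚ_p)`-equivalent, `KEquiv.pgl2Equiv_of_invariants_eq`).

These pairs `(I, J)` are exactly the points of `F_p^{inv} = {(−3A, −27B) : p⁴ ∤ A or p⁶ ∤ B}`
(`invariantPairsAdic`) off the null set `IJ(4I³ − J²) = 0`, for the family `F` of all elliptic
curves.

## References

* M. Bhargava, A. Shankar, Ann. of Math. (2) 181 (2015) 191–242 = arXiv:1006.1002, proof of
  Prop. 5.12 and of Thm 5.6 (arXiv v2 numbering). [cite: BhargavaShankarAnnals2015, Prop. 5.12 proof (B_p^{I,J} ⊂ V_{ℤ_p}; arXiv:1006.1002v2 numbering)]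
-/

noncomputable section

open scoped Classical
open Matrix

namespace Literature.NumberTheory.EllipticCurves

namespace BinaryQuartic

/-! ## §1 `K`-equivalence with equal invariants is `PGL₂(K)`-equivalence -/

section Field

variable {K : Type*} [Field K]

/-- **`K`-equivalent forms with the same invariants `I ≠ 0`, `J ≠ 0` are `PGL₂(K)`-equivalent**
(Bhargava–Shankar, end of the proof of Thm 5.6, over any field: if `g = μ²(f∘γ)` has the invariants
of `f` then `t = (μ det γ)²` satisfies `t² = 1 = t³`, so `t = 1` and `g = det(γ)⁻²(f∘γ)`).
[cite: BhargavaShankarAnnals2015, Thm 5.6 (proof, p. 32; arXiv:1006.1002v2 numbering)] -/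
theorem KEquiv.pgl2Equiv_of_invariants_eq {f g : BinaryQuartic K} (h : KEquiv f g)
    (hI : g.I = f.I) (hJ : g.J = f.J) (hI0 : f.I ≠ 0) (hJ0 : f.J ≠ 0) : PGL2Equiv f g := by
  obtain ⟨μ, hμ, γ, hγ, rfl⟩ := h
  rw [I_smul, I_subst] at hI
  rw [J_smul, J_subst] at hJ
  have h4 : ((μ * γ.det) ^ 2) ^ 2 = 1 := by
    apply mul_right_cancel₀ hI0
    linear_combination hI
  have h6 : ((μ * γ.det) ^ 2) ^ 3 = 1 := by
    apply mul_right_cancel₀ hJ0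
    linear_combination hJ
  have ht : (μ * γ.det) ^ 2 = 1 := by
    have hne : ((μ * γ.det) ^ 2) ^ 2 ≠ 0 := by rw [h4]; exact one_ne_zero
    calc (μ * γ.det) ^ 2 = ((μ * γ.det) ^ 2) ^ 3 / ((μ * γ.det) ^ 2) ^ 2 := by
          rw [eq_div_iff hne]; ring
      _ = 1 := by rw [h6, h4, div_one]
  refine ⟨γ, hγ, ?_⟩
  congr 1
  field_simp
  linear_combination ht

end Field

/-! ## §2 Scaling a `p`-adic form into `V_{ℤ_p}` -/

variable {p : ℕ} [Fact p.Prime]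

/-- For `x ∈ ℚ_p` there is `n` with `pᵐ x ∈ ℤ_p` for all `m ≥ n`. [folklore] -/
theorem exists_forall_norm_pow_mul_le_one (x : ℚ_[p]) : ∃ n : ℕ, ∀ m, n ≤ m → ‖(p : ℚ_[p]) ^ m * x‖ ≤ 1 := by
  have hp1 : (1 : ℝ) < p := by exact_mod_cast (Fact.out : p.Prime).one_lt
  have hpR : (0 : ℝ) < p := by positivity
  obtain ⟨n, hn⟩ := pow_unbounded_of_one_lt ‖x‖ hp1
  refine ⟨n, fun m hm ↦ ?_⟩
  rw [norm_mul, norm_pow, Padic.norm_p, inv_pow]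
  have hxm : ‖x‖ ≤ (p : ℝ) ^ m := hn.le.trans (pow_le_pow_right₀ hp1.le hm)
  rw [inv_mul_le_iff₀ (pow_pos hpR m), mul_one]
  exact hxm

/-- **Scaling into `V_{ℤ_p}`**: for `f ∈ V_{ℚ_p}` there are `k` and `g₀ ∈ V_{ℤ_p}` with
`g₀ = (pᵏ)² · f`. [folklore] -/
theorem exists_integral_eq_pow_sq_smul (f : BinaryQuartic ℚ_[p]) :
    ∃ (k : ℕ) (g₀ : BinaryQuartic ℤ_[p]), g₀.map PadicInt.Coe.ringHom = ((p : ℚ_[p]) ^ k) ^ 2 • f := by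
  obtain ⟨na, ha⟩ := exists_forall_norm_pow_mul_le_one f.a
  obtain ⟨nb, hb⟩ := exists_forall_norm_pow_mul_le_one f.b
  obtain ⟨nc, hc⟩ := exists_forall_norm_pow_mul_le_one f.c
  obtain ⟨nd, hd⟩ := exists_forall_norm_pow_mul_le_one f.d
  obtain ⟨ne, he⟩ := exists_forall_norm_pow_mul_le_one f.e
  set k : ℕ := na + nb + nc + nd + ne with hk
  have h2k : ((p : ℚ_[p]) ^ k) ^ 2 = (p : ℚ_[p]) ^ (2 * k) := by rw [← pow_mul, mul_comm]
  refine ⟨k, ⟨⟨_, ha (2 * k) (by omega)⟩, ⟨_, hb (2 * k) (by omega)⟩, ⟨_, hc (2 * k) (by omega)⟩,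
    ⟨_, hd (2 * k) (by omega)⟩, ⟨_, he (2 * k) (by omega)⟩⟩, ?_⟩
  ext <;> simp [map, h2k]

/-! ## §3 One minimisation step at the residue characteristic at hand -/

/-- The discriminant of a form with invariants `(t⁴·2⁴·(−3A), t⁶·2⁶·(−27B))`, `t ≠ 0`, is nonzero
when `4A³ + 27B² ≠ 0`. [folklore] -/
theorem disc_ne_zero_of_invariants_level {A B t : ℤ_[p]} (ht : t ≠ 0) (hΔ : 4 * A ^ 3 + 27 * B ^ 2 ≠ 0)
    {g : BinaryQuartic ℤ_[p]} (hI : g.I = t ^ 4 * (2 ^ 4 * (-3 * A))) (hJ : g.J = t ^ 6 * (2 ^ 6 * (-27 * B))) :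
    g.disc ≠ 0 := by
  intro h0
  have h27 := twentySeven_mul_disc g
  rw [h0, mul_zero, hI, hJ] at h27
  have : (27 * 2 ^ 12 : ℤ_[p]) * t ^ 12 * (4 * A ^ 3 + 27 * B ^ 2) = 0 := by linear_combination h27
  rcases mul_eq_zero.mp this with h1 | h1
  · rcases mul_eq_zero.mp h1 with h2 | h2
    · norm_num at h2
    · exact ht (pow_eq_zero_iff (by norm_num) |>.mp h2)
  · exact hΔ h1

/-- **One minimisation step** (Lemma 5.3, 5.4 or 5.5 over `ℤ_p` according as `p ≥ 5`, `p = 3`,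
`p = 2`): an integral `ℚ_p`-soluble `g` with invariants `(p^{4(k+1)}·2⁴·(−3A), p^{6(k+1)}·2⁶·(−27B))`,
`4A³ + 27B² ≠ 0`, is `ℚ_p`-equivalent to an integral form with invariants
`(p^{4k}·2⁴·(−3A), p^{6k}·2⁶·(−27B))` — the divisibility hypotheses of the three lemmas hold for
such invariants (`3 ∣ I`, `27 ∣ J` being used at `p = 3`, and `2⁴ ∣ I`, `2⁶ ∣ J` at `p = 2`).
[cite: BhargavaShankarAnnals2015, Thm 5.6 proof and Lemmas 5.3–5.5 (arXiv:1006.1002v2 numbering)] -/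
theorem exists_integral_kEquiv_step (A B : ℤ_[p]) (hΔ : 4 * A ^ 3 + 27 * B ^ 2 ≠ 0) (k : ℕ)
    (g : BinaryQuartic ℤ_[p]) (hI : g.I = ((p : ℤ_[p]) ^ (k + 1)) ^ 4 * (2 ^ 4 * (-3 * A)))
    (hJ : g.J = ((p : ℤ_[p]) ^ (k + 1)) ^ 6 * (2 ^ 6 * (-27 * B)))
    (hsol : (g.map PadicInt.Coe.ringHom).IsSoluble) :
    ∃ g₁ : BinaryQuartic ℤ_[p], KEquiv (g.map PadicInt.Coe.ringHom) (g₁.map PadicInt.Coe.ringHom) ∧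
      g₁.I = ((p : ℤ_[p]) ^ k) ^ 4 * (2 ^ 4 * (-3 * A)) ∧ g₁.J = ((p : ℤ_[p]) ^ k) ^ 6 * (2 ^ 6 * (-27 * B)) := by
  have hp0 : (p : ℤ_[p]) ≠ 0 := by exact_mod_cast (Fact.out : p.Prime).ne_zero
  have hΔg : g.disc ≠ 0 := disc_ne_zero_of_invariants_level (pow_ne_zero _ hp0) hΔ hI hJ
  -- the shape of the conclusion from `p⁴ I(g₁) = I(g)`, `p⁶ J(g₁) = J(g)`
  have finish : ∀ g₁ : BinaryQuartic ℤ_[p], (p : ℤ_[p]) ^ 4 * g₁.I = g.I → (p : ℤ_[p]) ^ 6 * g₁.J = g.J →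
      g₁.I = ((p : ℤ_[p]) ^ k) ^ 4 * (2 ^ 4 * (-3 * A)) ∧ g₁.J = ((p : ℤ_[p]) ^ k) ^ 6 * (2 ^ 6 * (-27 * B)) := by
    intro g₁ h4 h6
    constructor
    · apply mul_left_cancel₀ (pow_ne_zero 4 hp0)
      rw [h4, hI]; ring
    · apply mul_left_cancel₀ (pow_ne_zero 6 hp0)
      rw [h6, hJ]; ring
  -- divisibilities valid for every `p`
  have hI4 : (p : ℤ_[p]) ^ 4 ∣ g.I := ⟨(p : ℤ_[p]) ^ (4 * k) * (2 ^ 4 * (-3 * A)), by rw [hI]; ring⟩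
  have hJ6 : (p : ℤ_[p]) ^ 6 ∣ g.J := ⟨(p : ℤ_[p]) ^ (6 * k) * (2 ^ 6 * (-27 * B)), by rw [hJ]; ring⟩
  -- the residue characteristic
  rcases Nat.lt_or_ge p 5 with hp5 | hp5
  · -- `p = 2` or `p = 3`
    have hp2 : p = 2 ∨ p = 3 := by
      have := (Fact.out : p.Prime).two_le
      interval_cases p
      · exact Or.inl rfl
      · exact Or.inr rfl
      · exact absurd (Fact.out : Nat.Prime 4) (by decide)
    rcases hp2 with rfl | rfl
    · -- `p = 2`
      have hI' : (2 : ℤ_[2]) ^ 6 ∣ g.I := ⟨(2 : ℤ_[2]) ^ (4 * k + 2) * (-3 * A), by rw [hI]; push_cast; ring⟩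
      have hJ' : (2 : ℤ_[2]) ^ 9 ∣ g.J := ⟨(2 : ℤ_[2]) ^ (6 * k + 3) * (-27 * B), by rw [hJ]; push_cast; ring⟩
      have hIJ' : (2 : ℤ_[2]) ^ 10 ∣ 8 * g.I + g.J :=
        ⟨(2 : ℤ_[2]) ^ (4 * k + 1) * (-3 * A) + (2 : ℤ_[2]) ^ (6 * k + 2) * (-27 * B), by rw [hI, hJ]; push_cast; ring⟩
      obtain ⟨g₁, hK, h4, h6⟩ := padic_minimisation_two g hΔg hI' hJ' hIJ' hsol
      exact ⟨g₁, hK, finish g₁ (by simpa using h4) (by simpa using h6)⟩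
    · -- `p = 3`
      have hI' : (3 : ℤ_[3]) ^ 5 ∣ g.I := ⟨(3 : ℤ_[3]) ^ (4 * k) * (2 ^ 4 * (-A)), by rw [hI]; push_cast; ring⟩
      have hJ' : (3 : ℤ_[3]) ^ 9 ∣ g.J := ⟨(3 : ℤ_[3]) ^ (6 * k) * (2 ^ 6 * (-B)), by rw [hJ]; push_cast; ring⟩
      obtain ⟨g₁, hK, h4, h6⟩ := padic_minimisation_three g hΔg hI' hJ' hsol
      exact ⟨g₁, hK, finish g₁ (by simpa using h4) (by simpa using h6)⟩
  · obtain ⟨g₁, hK, h4, h6⟩ := padic_minimisation_prime_five_le hp5 g hΔg hI4 hJ6 hsol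
    exact ⟨g₁, hK, finish g₁ h4 h6⟩

/-- **Minimisation down to level zero**: an integral `ℚ_p`-soluble `g` with invariants
`(p^{4k}·2⁴·(−3A), p^{6k}·2⁶·(−27B))`, `4A³ + 27B² ≠ 0`, is `ℚ_p`-equivalent to an integral form with
invariants `(2⁴·(−3A), 2⁶·(−27B))`. [cite: BhargavaShankarAnnals2015, Thm 5.6 proof ("multiple times if necessary"; arXiv:1006.1002v2 numbering)] -/
theorem exists_integral_kEquiv_of_level (A B : ℤ_[p]) (hΔ : 4 * A ^ 3 + 27 * B ^ 2 ≠ 0) (k : ℕ) :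
    ∀ g : BinaryQuartic ℤ_[p], g.I = ((p : ℤ_[p]) ^ k) ^ 4 * (2 ^ 4 * (-3 * A)) →
      g.J = ((p : ℤ_[p]) ^ k) ^ 6 * (2 ^ 6 * (-27 * B)) → (g.map PadicInt.Coe.ringHom).IsSoluble →
      ∃ g' : BinaryQuartic ℤ_[p], KEquiv (g.map PadicInt.Coe.ringHom) (g'.map PadicInt.Coe.ringHom) ∧
        g'.I = 2 ^ 4 * (-3 * A) ∧ g'.J = 2 ^ 6 * (-27 * B) := by
  induction k with
  | zero =>
    intro g hI hJ _
    exact ⟨g, KEquiv.refl _, by simpa using hI, by simpa using hJ⟩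
  | succ k ih =>
    intro g hI hJ hsol
    obtain ⟨g₁, hK₁, hI₁, hJ₁⟩ := exists_integral_kEquiv_step A B hΔ k g hI hJ hsol
    have hsol₁ : (g₁.map PadicInt.Coe.ringHom).IsSoluble := hK₁.isSoluble_iff.mpr hsol
    obtain ⟨g', hK', hI', hJ'⟩ := ih g₁ hI₁ hJ₁ hsol₁
    exact ⟨g', hK₁.trans hK', hI', hJ'⟩

/-! ## §4 Integral representatives of the soluble classes -/

/-- **Bhargava–Shankar, proof of Prop. 5.12: `B_p^{I,J} ⊂ V_{ℤ_p}`.** Let `(I, J) = (−3A, −27B)`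
with `A, B ∈ ℤ_p`, `A ≠ 0`, `B ≠ 0`, `4A³ + 27B² ≠ 0` (a point of `F_p^{inv}` off a null set).
Then every `ℚ_p`-soluble binary quartic form over `ℚ_p` with invariants `(2⁴I, 2⁶J)` is
`PGL₂(ℚ_p)`-equivalent to a form with coefficients in `ℤ_p`: the soluble `PGL₂(ℚ_p)`-classes with
these invariants are represented by integral forms. [cite: BhargavaShankarAnnals2015, Prop. 5.12 proof (arXiv:1006.1002v2 numbering)] -/
theorem exists_integral_pgl2Equiv_of_isSoluble (A B : ℤ_[p]) (hA : A ≠ 0) (hB : B ≠ 0)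
    (hΔ : 4 * A ^ 3 + 27 * B ^ 2 ≠ 0) {f : BinaryQuartic ℚ_[p]}
    (hfI : f.I = ((2 ^ 4 * (-3 * A) : ℤ_[p]) : ℚ_[p])) (hfJ : f.J = ((2 ^ 6 * (-27 * B) : ℤ_[p]) : ℚ_[p]))
    (hsol : f.IsSoluble) :
    ∃ g : BinaryQuartic ℤ_[p], PGL2Equiv f (g.map PadicInt.Coe.ringHom) := by
  have hp0 : (p : ℚ_[p]) ≠ 0 := Nat.cast_ne_zero.mpr (Fact.out : p.Prime).ne_zero
  -- scale into `V_{ℤ_p}`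
  obtain ⟨k, g₀, hg₀⟩ := exists_integral_eq_pow_sq_smul f
  have hK₀ : KEquiv f (g₀.map PadicInt.Coe.ringHom) :=
    ⟨(p : ℚ_[p]) ^ k, pow_ne_zero _ hp0, 1, by simp, by rw [subst_one, hg₀]⟩
  have hI₀ : g₀.I = ((p : ℤ_[p]) ^ k) ^ 4 * (2 ^ 4 * (-3 * A)) := by
    apply Subtype.coe_injective
    have := congrArg BinaryQuartic.I hg₀
    rw [I_map, I_smul, hfI] at this
    change ((g₀.I : ℤ_[p]) : ℚ_[p]) = _ at this
    change ((g₀.I : ℤ_[p]) : ℚ_[p]) = (((((p : ℤ_[p]) ^ k) ^ 4 * (2 ^ 4 * (-3 * A))) : ℤ_[p]) : ℚ_[p])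
    rw [this]; push_cast; ring
  have hJ₀ : g₀.J = ((p : ℤ_[p]) ^ k) ^ 6 * (2 ^ 6 * (-27 * B)) := by
    apply Subtype.coe_injective
    have := congrArg BinaryQuartic.J hg₀
    rw [J_map, J_smul, hfJ] at this
    change ((g₀.J : ℤ_[p]) : ℚ_[p]) = _ at this
    change ((g₀.J : ℤ_[p]) : ℚ_[p]) = (((((p : ℤ_[p]) ^ k) ^ 6 * (2 ^ 6 * (-27 * B))) : ℤ_[p]) : ℚ_[p])
    rw [this]; push_cast; ring
  have hsol₀ : (g₀.map PadicInt.Coe.ringHom).IsSoluble := hK₀.isSoluble_iff.mpr hsol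
  -- minimise `k` times
  obtain ⟨g, hK, hIg, hJg⟩ := exists_integral_kEquiv_of_level A B hΔ k g₀ hI₀ hJ₀ hsol₀
  refine ⟨g, (hK₀.trans hK).pgl2Equiv_of_invariants_eq ?_ ?_ ?_ ?_⟩
  · rw [I_map, hIg, hfI]; rfl
  · rw [J_map, hJg, hfJ]; rfl
  · rw [hfI, Ne, PadicInt.coe_eq_zero]
    exact mul_ne_zero (by norm_num) (mul_ne_zero (by norm_num) hA)
  · rw [hfJ, Ne, PadicInt.coe_eq_zero]
    exact mul_ne_zero (by norm_num) (mul_ne_zero (by norm_num) hB)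

/-- The same for the invariant pairs as they appear in the local masses: for
`IJ ∈ invariantPairsAdic p` (`= F_p^{inv}` of the family of all curves) with `IJ.1 ≠ 0`,
`IJ.2 ≠ 0`, `4 IJ.1³ ≠ IJ.2²`, every `ℚ_p`-soluble form with invariants `(2⁴ IJ.1, 2⁶ IJ.2)` is
`PGL₂(ℚ_p)`-equivalent to an integral one. [cite: BhargavaShankarAnnals2015, Prop. 5.12 proof (arXiv:1006.1002v2 numbering)] -/
theorem exists_integral_pgl2Equiv_of_mem_invariantPairsAdic {IJ : ℤ_[p] × ℤ_[p]}
    (hIJ : IJ ∈ invariantPairsAdic p) (h1 : IJ.1 ≠ 0) (h2 : IJ.2 ≠ 0) (hΔ : 4 * IJ.1 ^ 3 - IJ.2 ^ 2 ≠ 0)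
    {f : BinaryQuartic ℚ_[p]} (hfI : f.I = ((2 ^ 4 * IJ.1 : ℤ_[p]) : ℚ_[p]))
    (hfJ : f.J = ((2 ^ 6 * IJ.2 : ℤ_[p]) : ℚ_[p])) (hsol : f.IsSoluble) :
    ∃ g : BinaryQuartic ℤ_[p], PGL2Equiv f (g.map PadicInt.Coe.ringHom) := by
  obtain ⟨I, J⟩ := IJ
  obtain ⟨⟨A, B⟩, -, hAB⟩ := (mem_invariantPairsAdic_iff p _).mp hIJ
  simp only [Prod.mk.injEq] at hAB
  obtain ⟨rfl, rfl⟩ := hAB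
  dsimp only at h1 h2 hΔ hfI hfJ
  have hA : A ≠ 0 := by rintro rfl; exact h1 (by simp)
  have hB : B ≠ 0 := by rintro rfl; exact h2 (by simp)
  have hΔ' : 4 * A ^ 3 + 27 * B ^ 2 ≠ 0 := by
    intro h0; apply hΔ
    linear_combination (-27 : ℤ_[p]) * h0
  exact exists_integral_pgl2Equiv_of_isSoluble A B hA hB hΔ' hfI hfJ hsol

end BinaryQuartic

end Literature.NumberTheory.EllipticCurves

end
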